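import Literature.Barriers.PneNP.TSPExtensionComplexityRothvossProofs

/-!
# The positive part of Rothvoß's weight datum (`W ≤ kern3`, `Σ kern3 ≤ 1`)

Rothvoß's hyperplane `W = -[|δ(U) ∩ M| = 1] + kern3 - kernK/(k-1)` on (`t`-cuts) × (perfect matchings)
[cite: Rothvoss2017, §2 eq. (2) and Lemma 6 (PDF p. 6)] is dominated pointwise by the `μ₃`-kernel
`kern3 ≥ 0`, whose total mass is `μ₃(everything) ≤ 1`. This file records that domination next to the
datum of `exists_W_slot` (all rectangle sums `≤ 2θ`, `⟨W, S⟩ = 1`): `exists_WK_slot`, its transport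
along a bijection of the vertex type `exists_WK_transport`, and the instance at Rothvoß's constants
`exists_WK_fin` on `Fin n`, `n = |Slot m 72|`. Consumers: hyperplane-separation bounds for
factorizations through SMALL PSD BLOCKS (second-order-cone lifts), where the garbage part of a block is
charged against `Σ kern3` and the sandwich error against `⟨kern3, S⟩`.

[cite: Rothvoss2017, §2 (PDF p. 6), §3.2 (PDF p. 9)]
-/

noncomputable section

open scoped Classical

namespace Literature.Barriers.PneNP

open Finset Slot

variable {m q : ℕ}

section

variable (μ : ℕ)

/-- `g3 ≥ 0`. [folklore] -/
private theorem g3_nonneg (π : Equiv.Perm (Slot m q)) (U : Finset (Slot m q)) (M : Finset (Sym2 (Slot m q))) :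
    0 ≤ g3 μ π U M := by
  unfold g3
  refine div_nonneg (mul_nonneg ?_ ?_) (mul_nonneg (Nat.cast_nonneg _) (Nat.cast_nonneg _)) <;>
    split_ifs <;> norm_num

/-- `gK ≥ 0`. [folklore] -/
private theorem gK_nonneg (π : Equiv.Perm (Slot m q)) (U : Finset (Slot m q)) (M : Finset (Sym2 (Slot m q))) :
    0 ≤ gK μ π U M := by
  unfold gK
  refine div_nonneg (mul_nonneg ?_ ?_) (mul_nonneg (Nat.cast_nonneg _) (Nat.cast_nonneg _)) <;>
    split_ifs <;> norm_num

/-- `kern3 ≥ 0`. [cite: Rothvoss2017, §3.2 (PDF p. 9)] -/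
theorem kern3_nonneg (U : Finset (Slot m q)) (M : Finset (Sym2 (Slot m q))) : 0 ≤ kern3 μ U M := by
  unfold kern3
  exact div_nonneg (sum_nonneg fun π _ => g3_nonneg μ π U M) (Nat.cast_nonneg _)

/-- `kernK ≥ 0`. [cite: Rothvoss2017, §3.2 (PDF p. 9)] -/
theorem kernK_nonneg (U : Finset (Slot m q)) (M : Finset (Sym2 (Slot m q))) : 0 ≤ kernK μ U M := by
  unfold kernK
  exact div_nonneg (sum_nonneg fun π _ => gK_nonneg μ π U M) (Nat.cast_nonneg _)

/-- **`W ≤ kern3` pointwise** (drop the penalty and the `μ_k`-part). [cite: Rothvoss2017, §2 eq. (2) (PDF p. 6)] -/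
theorem Wmat_le_kern3 (U : Finset (Slot m q)) (M : Finset (Sym2 (Slot m q))) :
    Wmat q μ U M ≤ kern3 μ U M := by
  unfold Wmat
  have h1 : 0 ≤ (if (M.filter fun e => cutCount U e = 1).card = 1 then (1 : ℝ) else 0) := by
    split_ifs <;> norm_num
  have h2 : 0 ≤ kernK μ U M / ((q : ℝ) + 2) := div_nonneg (kernK_nonneg μ U M) (by positivity)
  linarith

/-- `μ₃(ℛ) ≤ 1`. [cite: Rothvoss2017, §3.2 (PDF p. 9)] -/
theorem mu3_le_one (𝒰 : Finset (Finset (Slot m q))) (ℳ : Finset (Finset (Sym2 (Slot m q)))) :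
    mu3 μ 𝒰 ℳ ≤ 1 := by
  have hN : (0 : ℝ) < Fintype.card (Equiv.Perm (Slot m q)) := by exact_mod_cast Fintype.card_pos
  unfold mu3
  rw [div_le_one hN]
  exact sum_pp_le_card μ 𝒰 ℳ

/-- **The total `kern3`-mass over (`t`-cuts) × (perfect matchings) is at most `1`.**
[cite: Rothvoss2017, §3.2 (PDF p. 9)] -/
theorem sum_kern3_le_one :
    ∑ a : {U : Finset (Slot m q) // U.card = tCut q μ},
      ∑ b : {M : Finset (Sym2 (Slot m q)) // IsPMOn univ M}, kern3 μ a.1 b.1 ≤ 1 := by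
  have h := sum_kern3 μ
    ((univ : Finset {U : Finset (Slot m q) // U.card = tCut q μ}).map (Function.Embedding.subtype _))
    ((univ : Finset {M : Finset (Sym2 (Slot m q)) // IsPMOn univ M}).map (Function.Embedding.subtype _))
  simp only [sum_map, Function.Embedding.coe_subtype] at h
  rw [h]
  exact mu3_le_one μ _ _

variable (ε θ : ℝ)

/-- **Rothvoß's weight datum with its dominating kernel**: on (`t`-cuts) × (perfect matchings) of the
slot type, `W` has all rectangle sums `≤ 2θ` and `⟨W, S⟩ = 1` (`exists_W_slot`), and moreover
`W ≤ K` pointwise for a kernel `K ≥ 0` of total mass `≤ 1` (`K = kern3`).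
[cite: Rothvoss2017, Lemma 6 and §2 eq. (2) (PDF p. 6)] -/
theorem exists_WK_slot (hq : 0 < q) (hqe : Even q) (hm : m = 2 * μ + 1) (hε : 0 < ε)
    (hθ : 0 < θ) (hθ1 : θ ≤ 1)
    (hβU : (Real.log 2 + Real.log ((m : ℝ) + 1) - Real.log θ) / cU ε ≤ ((μ : ℝ) + 1) / 4)
    (hβM : ((2 * q).factorial : ℝ) * ((Real.log (Qbound q : ℝ) - Real.log θ) / cM q ε) ≤ (m : ℝ) / 4)
    (hk : 2 * ((1 + ε) ^ 3 * ((3 * (q + 3) : ℝ) / Nat.choose (q + 3) 3)) ≤ 1 / ((q : ℝ) + 2)) :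
    ∃ W K : {U : Finset (Slot m q) // U.card = tCut q μ} → {M : Finset (Sym2 (Slot m q)) // IsPMOn univ M} → ℝ,
      (∀ (X : Finset {U : Finset (Slot m q) // U.card = tCut q μ})
          (Y : Finset {M : Finset (Sym2 (Slot m q)) // IsPMOn univ M}),
          ∑ a ∈ X, ∑ b ∈ Y, W a b ≤ 2 * θ) ∧
        ∑ a, ∑ b, W a b * ((((b : Finset (Sym2 (Slot m q))).filter
          fun f => cutCount (a : Finset (Slot m q)) f = 1).card : ℝ) - 1) = 1 ∧
        (∀ a b, W a b ≤ K a b) ∧ (∀ a b, 0 ≤ K a b) ∧ ∑ a, ∑ b, K a b ≤ 1 := by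
  refine ⟨fun a b => Wmat q μ a.1 b.1, fun a b => kern3 μ a.1 b.1, fun X Y => ?_,
    sum_Wmat_slack hq hqe hm, fun a b => Wmat_le_kern3 μ a.1 b.1, fun a b => kern3_nonneg μ a.1 b.1,
    sum_kern3_le_one μ⟩
  have := rect_le μ ε θ (X.map (Function.Embedding.subtype _)) (Y.map (Function.Embedding.subtype _))
    hq hqe hm hε hθ hθ1 hβU hβM hk
  simpa only [sum_map, Function.Embedding.coe_subtype] using this

end

/-- **Transport of the dominated weight datum along a bijection of the vertex type** (the datum of
Rothvoß's Lemma 6 / eq. (2) together with its dominating kernel, relabelled).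
[cite: Rothvoss2017, Lemma 6 and §2 eq. (2) (PDF p. 6)] -/
theorem exists_WK_transport {V V' : Type*} [DecidableEq V] [DecidableEq V'] [Fintype V] [Fintype V']
    (e : V ≃ V') (t : ℕ) (α s κ : ℝ)
    (h : ∃ W K : {U : Finset V // U.card = t} → {M : Finset (Sym2 V) // IsPMOn univ M} → ℝ,
      (∀ (X : Finset {U : Finset V // U.card = t}) (Y : Finset {M : Finset (Sym2 V) // IsPMOn univ M}),
          ∑ a ∈ X, ∑ b ∈ Y, W a b ≤ α) ∧
        ∑ a, ∑ b, W a b * ((((b : Finset (Sym2 V)).filter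
          fun f => cutCount (a : Finset V) f = 1).card : ℝ) - 1) = s ∧
        (∀ a b, W a b ≤ K a b) ∧ (∀ a b, 0 ≤ K a b) ∧ ∑ a, ∑ b, K a b ≤ κ) :
    ∃ W K : {U : Finset V' // U.card = t} → {M : Finset (Sym2 V') // IsPMOn univ M} → ℝ,
      (∀ (X : Finset {U : Finset V' // U.card = t}) (Y : Finset {M : Finset (Sym2 V') // IsPMOn univ M}),
          ∑ a ∈ X, ∑ b ∈ Y, W a b ≤ α) ∧
        ∑ a, ∑ b, W a b * ((((b : Finset (Sym2 V')).filter
          fun f => cutCount (a : Finset V') f = 1).card : ℝ) - 1) = s ∧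
        (∀ a b, W a b ≤ K a b) ∧ (∀ a b, 0 ≤ K a b) ∧ ∑ a, ∑ b, K a b ≤ κ := by
  obtain ⟨W, K, hrect, hsum, hWK, hK0, hKsum⟩ := h
  set eU := cutEquiv e t with heU
  set eM := pmEquiv e with heM
  refine ⟨fun a b => W (eU.symm a) (eM.symm b), fun a b => K (eU.symm a) (eM.symm b),
    fun X Y => ?_, ?_, fun a b => hWK _ _, fun a b => hK0 _ _, ?_⟩
  · have := hrect (X.map eU.symm.toEmbedding) (Y.map eM.symm.toEmbedding)
    simpa [sum_map] using this
  · rw [← hsum, ← Equiv.sum_comp eU]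
    refine sum_congr rfl fun a _ => ?_
    rw [← Equiv.sum_comp eM]
    refine sum_congr rfl fun b _ => ?_
    dsimp only
    rw [Equiv.symm_apply_apply, Equiv.symm_apply_apply, heU, heM, card_cut_equiv]
  · rw [← Equiv.sum_comp eU.symm] at hKsum
    refine le_trans (le_of_eq (sum_congr rfl fun a _ => ?_)) hKsum
    rw [← Equiv.sum_comp eM.symm]

/-- **The dominated weight datum on `Fin n`, `n = |Slot m 72|`, at Rothvoß's constants**
(`m = 2μ+1` large): on (`t`-cuts of `Fin n`) × (perfect matchings of `K_n`) there are `W ≤ K`,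
`K ≥ 0`, `Σ K ≤ 1`, with all rectangle sums of `W` at most `2 θ_R(m) = 2·2^{-δ_R m}` and `⟨W, S⟩ = 1`.
[cite: Rothvoss2017, Thm. 1 with Lemma 6 (PDF pp. 4–6)] -/
theorem exists_WK_fin (μ : ℕ) {m : ℕ} (hm : m = 2 * μ + 1)
    (hU1 : (64 / cU εR) ^ 2 ≤ (m : ℝ) + 1) (hU2 : 32 / cU εR ≤ (m : ℝ) + 1)
    (hM1 : 16 * FQ * Real.log QB / cM qR εR ≤ (m : ℝ)) :
    ∃ W K : {U : Finset (Fin (Fintype.card (Slot m qR))) // U.card = tCut qR μ} →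
        {M : Finset (Sym2 (Fin (Fintype.card (Slot m qR)))) // IsPMOn univ M} → ℝ,
      (∀ (X : Finset {U : Finset (Fin (Fintype.card (Slot m qR))) // U.card = tCut qR μ})
          (Y : Finset {M : Finset (Sym2 (Fin (Fintype.card (Slot m qR)))) // IsPMOn univ M}),
          ∑ a ∈ X, ∑ b ∈ Y, W a b ≤ 2 * θR m) ∧
        ∑ a, ∑ b, W a b * ((((b : Finset (Sym2 (Fin (Fintype.card (Slot m qR))))).filter
          fun f => cutCount (a : Finset (Fin (Fintype.card (Slot m qR)))) f = 1).card : ℝ) - 1) = 1 ∧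
        (∀ a b, W a b ≤ K a b) ∧ (∀ a b, 0 ≤ K a b) ∧ ∑ a, ∑ b, K a b ≤ 1 := by
  have hq : 0 < qR := by unfold qR; norm_num
  have hqe : Even qR := by unfold qR; decide
  have hε : (0 : ℝ) < εR := by unfold εR; norm_num
  exact exists_WK_transport (Fintype.equivFin (Slot m qR)) (tCut qR μ) (2 * θR m) 1 1
    (exists_WK_slot (m := m) (q := qR) μ εR (θR m) hq hqe hm hε (θR_pos m) (θR_le_one m)
      (betaU_ok μ hm hU1 hU2) (betaM_ok hM1) hk_num)

end Literature.Barriers.PneNP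

end

/-!
### The negative part of `W` off the tight pairs (appended 2026-08-27)

Off the tight pairs (`|δ(U) ∩ M| ≠ 1`) Rothvoß's weight is EXACTLY `W = kern3 − kernK/(k−1)`, and the
`μ_k`-kernel `kernK ≥ 0` has total mass `μ_k(everything) ≤ 1` [cite: Rothvoss2017, §2 eq. (2) (PDF p. 6),
§3.2 (PDF p. 9)]. Hence `Σ_{S ≠ 0} |W| ≤ Σ kern3 + Σ kernK/(k−1) ≤ 1 + 1/(k−1)`: the datum `⟨W, S⟩ = 1`
survives any perturbation of the slack matrix that is bounded OFF its zeros (consumer: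
`Summit.PneNP.PneNP.Theorems.SupportRectangleBlockLiftRobust`, the papers-lane robustness statement for the
small-block psd bound). `exists_WK2_slot` / `exists_WK2_transport` / `exists_WK2_fin` are `exists_WK_slot` /
`exists_WK_transport` / `exists_WK_fin` with the second kernel `K₂ = kernK/(k−1)` recorded.
-/

noncomputable section

open scoped Classical

namespace Literature.Barriers.PneNP

open Finset Slot

variable {m q : ℕ}

section

variable (μ : ℕ)

/-- `p^ex_{U,T}(C) ≤ 1`. [folklore] -/
private theorem pUC_le_one (𝒰 : Finset (Finset (Slot m q))) (π : Equiv.Perm (Slot m q)) : pUC μ 𝒰 π ≤ 1 :=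
  div_le_one_of_le₀ (by exact_mod_cast card_le_card inter_subset_left) (Nat.cast_nonneg _)

/-- `p^ex_{M,T}(F) ≤ 1`. [folklore] -/
private theorem pMF_le_one (ℳ : Finset (Finset (Sym2 (Slot m q)))) (π : Equiv.Perm (Slot m q)) : pMF ℳ π ≤ 1 :=
  div_le_one_of_le₀ (by exact_mod_cast card_le_card inter_subset_left) (Nat.cast_nonneg _)

/-- `μ_k(ℛ) ≤ 1`. [cite: Rothvoss2017, §3.2 (PDF p. 9)] -/
theorem muK_le_one (𝒰 : Finset (Finset (Slot m q))) (ℳ : Finset (Finset (Sym2 (Slot m q)))) :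
    muK μ 𝒰 ℳ ≤ 1 := by
  have hN : (0 : ℝ) < Fintype.card (Equiv.Perm (Slot m q)) := by exact_mod_cast Fintype.card_pos
  unfold muK
  rw [div_le_one hN]
  calc ∑ π : Equiv.Perm (Slot m q), pUC μ 𝒰 π * pMF ℳ π ≤ ∑ _π : Equiv.Perm (Slot m q), (1 : ℝ) :=
        sum_le_sum fun π _ => by
          calc pUC μ 𝒰 π * pMF ℳ π ≤ 1 * 1 :=
                mul_le_mul (pUC_le_one μ 𝒰 π) (pMF_le_one ℳ π) (pMF_nonneg ℳ π) zero_le_one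
            _ = 1 := one_mul 1
    _ = Fintype.card (Equiv.Perm (Slot m q)) := by simp

/-- **The total `kernK`-mass over (`t`-cuts) × (perfect matchings) is at most `1`.**
[cite: Rothvoss2017, §3.2 (PDF p. 9)] -/
theorem sum_kernK_le_one :
    ∑ a : {U : Finset (Slot m q) // U.card = tCut q μ},
      ∑ b : {M : Finset (Sym2 (Slot m q)) // IsPMOn univ M}, kernK μ a.1 b.1 ≤ 1 := by
  have h := sum_kernK μ
    ((univ : Finset {U : Finset (Slot m q) // U.card = tCut q μ}).map (Function.Embedding.subtype _))
    ((univ : Finset {M : Finset (Sym2 (Slot m q)) // IsPMOn univ M}).map (Function.Embedding.subtype _))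
  simp only [sum_map, Function.Embedding.coe_subtype] at h
  rw [h]
  exact muK_le_one μ _ _

/-- **Off the tight pairs, `W = kern3 − kernK/(k−1)` exactly** (`k − 1 = q + 2`).
[cite: Rothvoss2017, §2 eq. (2) (PDF p. 6)] -/
theorem Wmat_eq_of_card_ne_one (U : Finset (Slot m q)) (M : Finset (Sym2 (Slot m q)))
    (h : (M.filter fun e => cutCount U e = 1).card ≠ 1) :
    Wmat q μ U M = kern3 μ U M - kernK μ U M / ((q : ℝ) + 2) := by
  unfold Wmat
  rw [if_neg h]
  ring

variable (ε θ : ℝ)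

/-- **Rothvoß's weight datum with both kernels**: as `exists_WK_slot` (`W ≤ K = kern3`, `K ≥ 0`, `Σ K ≤ 1`,
rectangle sums `≤ 2θ`, `⟨W, S⟩ = 1`), and moreover `W = K − K₂` on every pair with `|δ(U) ∩ M| ≠ 1`, where
`K₂ = kernK/(k−1) ≥ 0` has total mass `≤ 1/(k−1) = 1/(q+2)`.
[cite: Rothvoss2017, Lemma 6 and §2 eq. (2) (PDF p. 6)] -/
theorem exists_WK2_slot (hq : 0 < q) (hqe : Even q) (hm : m = 2 * μ + 1) (hε : 0 < ε)
    (hθ : 0 < θ) (hθ1 : θ ≤ 1)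
    (hβU : (Real.log 2 + Real.log ((m : ℝ) + 1) - Real.log θ) / cU ε ≤ ((μ : ℝ) + 1) / 4)
    (hβM : ((2 * q).factorial : ℝ) * ((Real.log (Qbound q : ℝ) - Real.log θ) / cM q ε) ≤ (m : ℝ) / 4)
    (hk : 2 * ((1 + ε) ^ 3 * ((3 * (q + 3) : ℝ) / Nat.choose (q + 3) 3)) ≤ 1 / ((q : ℝ) + 2)) :
    ∃ W K K₂ : {U : Finset (Slot m q) // U.card = tCut q μ} →
        {M : Finset (Sym2 (Slot m q)) // IsPMOn univ M} → ℝ,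
      (∀ (X : Finset {U : Finset (Slot m q) // U.card = tCut q μ})
          (Y : Finset {M : Finset (Sym2 (Slot m q)) // IsPMOn univ M}),
          ∑ a ∈ X, ∑ b ∈ Y, W a b ≤ 2 * θ) ∧
        ∑ a, ∑ b, W a b * ((((b : Finset (Sym2 (Slot m q))).filter
          fun f => cutCount (a : Finset (Slot m q)) f = 1).card : ℝ) - 1) = 1 ∧
        (∀ a b, W a b ≤ K a b) ∧ (∀ a b, 0 ≤ K a b) ∧ ∑ a, ∑ b, K a b ≤ 1 ∧
        (∀ a b, 0 ≤ K₂ a b) ∧ ∑ a, ∑ b, K₂ a b ≤ 1 / ((q : ℝ) + 2) ∧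
        (∀ (a : {U : Finset (Slot m q) // U.card = tCut q μ}) (b : {M : Finset (Sym2 (Slot m q)) // IsPMOn univ M}),
          ((b : Finset (Sym2 (Slot m q))).filter
            (fun f => cutCount (a : Finset (Slot m q)) f = 1)).card ≠ 1 → W a b = K a b - K₂ a b) := by
  have hq2 : (0 : ℝ) < (q : ℝ) + 2 := by positivity
  refine ⟨fun a b => Wmat q μ a.1 b.1, fun a b => kern3 μ a.1 b.1,
    fun a b => kernK μ a.1 b.1 / ((q : ℝ) + 2), fun X Y => ?_,
    sum_Wmat_slack hq hqe hm, fun a b => Wmat_le_kern3 μ a.1 b.1, fun a b => kern3_nonneg μ a.1 b.1,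
    sum_kern3_le_one μ, fun a b => div_nonneg (kernK_nonneg μ a.1 b.1) hq2.le, ?_,
    fun a b hab => Wmat_eq_of_card_ne_one μ a.1 b.1 hab⟩
  · have := rect_le μ ε θ (X.map (Function.Embedding.subtype _)) (Y.map (Function.Embedding.subtype _))
      hq hqe hm hε hθ hθ1 hβU hβM hk
    simpa only [sum_map, Function.Embedding.coe_subtype] using this
  · simp only [← sum_div]
    exact div_le_div_of_nonneg_right (sum_kernK_le_one μ) hq2.le

end

/-- **Transport of the two-kernel weight datum along a bijection of the vertex type.**
[cite: Rothvoss2017, Lemma 6 and §2 eq. (2) (PDF p. 6)] -/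
theorem exists_WK2_transport {V V' : Type*} [DecidableEq V] [DecidableEq V'] [Fintype V] [Fintype V']
    (e : V ≃ V') (t : ℕ) (α s κ κ₂ : ℝ)
    (h : ∃ W K K₂ : {U : Finset V // U.card = t} → {M : Finset (Sym2 V) // IsPMOn univ M} → ℝ,
      (∀ (X : Finset {U : Finset V // U.card = t}) (Y : Finset {M : Finset (Sym2 V) // IsPMOn univ M}),
          ∑ a ∈ X, ∑ b ∈ Y, W a b ≤ α) ∧
        ∑ a, ∑ b, W a b * ((((b : Finset (Sym2 V)).filter
          fun f => cutCount (a : Finset V) f = 1).card : ℝ) - 1) = s ∧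
        (∀ a b, W a b ≤ K a b) ∧ (∀ a b, 0 ≤ K a b) ∧ ∑ a, ∑ b, K a b ≤ κ ∧
        (∀ a b, 0 ≤ K₂ a b) ∧ ∑ a, ∑ b, K₂ a b ≤ κ₂ ∧
        (∀ (a : {U : Finset V // U.card = t}) (b : {M : Finset (Sym2 V) // IsPMOn univ M}),
          ((b : Finset (Sym2 V)).filter (fun f => cutCount (a : Finset V) f = 1)).card ≠ 1 →
          W a b = K a b - K₂ a b)) :
    ∃ W K K₂ : {U : Finset V' // U.card = t} → {M : Finset (Sym2 V') // IsPMOn univ M} → ℝ,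
      (∀ (X : Finset {U : Finset V' // U.card = t}) (Y : Finset {M : Finset (Sym2 V') // IsPMOn univ M}),
          ∑ a ∈ X, ∑ b ∈ Y, W a b ≤ α) ∧
        ∑ a, ∑ b, W a b * ((((b : Finset (Sym2 V')).filter
          fun f => cutCount (a : Finset V') f = 1).card : ℝ) - 1) = s ∧
        (∀ a b, W a b ≤ K a b) ∧ (∀ a b, 0 ≤ K a b) ∧ ∑ a, ∑ b, K a b ≤ κ ∧
        (∀ a b, 0 ≤ K₂ a b) ∧ ∑ a, ∑ b, K₂ a b ≤ κ₂ ∧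
        (∀ (a : {U : Finset V' // U.card = t}) (b : {M : Finset (Sym2 V') // IsPMOn univ M}),
          ((b : Finset (Sym2 V')).filter (fun f => cutCount (a : Finset V') f = 1)).card ≠ 1 →
          W a b = K a b - K₂ a b) := by
  obtain ⟨W, K, K₂, hrect, hsum, hWK, hK0, hKsum, hK20, hK2sum, hWeq⟩ := h
  set eU := cutEquiv e t with heU
  set eM := pmEquiv e with heM
  refine ⟨fun a b => W (eU.symm a) (eM.symm b), fun a b => K (eU.symm a) (eM.symm b),
    fun a b => K₂ (eU.symm a) (eM.symm b),
    fun X Y => ?_, ?_, fun a b => hWK _ _, fun a b => hK0 _ _, ?_, fun a b => hK20 _ _, ?_,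
    fun a b hab => ?_⟩
  · have := hrect (X.map eU.symm.toEmbedding) (Y.map eM.symm.toEmbedding)
    simpa [sum_map] using this
  · rw [← hsum, ← Equiv.sum_comp eU]
    refine sum_congr rfl fun a _ => ?_
    rw [← Equiv.sum_comp eM]
    refine sum_congr rfl fun b _ => ?_
    dsimp only
    rw [Equiv.symm_apply_apply, Equiv.symm_apply_apply, heU, heM, card_cut_equiv]
  · rw [← Equiv.sum_comp eU.symm] at hKsum
    refine le_trans (le_of_eq (sum_congr rfl fun a _ => ?_)) hKsum
    rw [← Equiv.sum_comp eM.symm]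
  · rw [← Equiv.sum_comp eU.symm] at hK2sum
    refine le_trans (le_of_eq (sum_congr rfl fun a _ => ?_)) hK2sum
    rw [← Equiv.sum_comp eM.symm]
  · refine hWeq _ _ ?_
    have hc := card_cut_equiv e t (eU.symm a) (eM.symm b)
    rw [heU, heM] at hc ⊢
    rw [Equiv.apply_symm_apply, Equiv.apply_symm_apply] at hc
    rw [← hc]
    exact hab

/-- **The two-kernel weight datum on `Fin n`, `n = |Slot m 72|`, at Rothvoß's constants** (`m = 2μ+1`
large): as `exists_WK_fin`, plus `W = K − K₂` off the tight pairs with `K₂ ≥ 0`, `Σ K₂ ≤ 1/74`.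
[cite: Rothvoss2017, Thm. 1 with Lemma 6 and §2 eq. (2) (PDF pp. 4–6)] -/
theorem exists_WK2_fin (μ : ℕ) {m : ℕ} (hm : m = 2 * μ + 1)
    (hU1 : (64 / cU εR) ^ 2 ≤ (m : ℝ) + 1) (hU2 : 32 / cU εR ≤ (m : ℝ) + 1)
    (hM1 : 16 * FQ * Real.log QB / cM qR εR ≤ (m : ℝ)) :
    ∃ W K K₂ : {U : Finset (Fin (Fintype.card (Slot m qR))) // U.card = tCut qR μ} →
        {M : Finset (Sym2 (Fin (Fintype.card (Slot m qR)))) // IsPMOn univ M} → ℝ,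
      (∀ (X : Finset {U : Finset (Fin (Fintype.card (Slot m qR))) // U.card = tCut qR μ})
          (Y : Finset {M : Finset (Sym2 (Fin (Fintype.card (Slot m qR)))) // IsPMOn univ M}),
          ∑ a ∈ X, ∑ b ∈ Y, W a b ≤ 2 * θR m) ∧
        ∑ a, ∑ b, W a b * ((((b : Finset (Sym2 (Fin (Fintype.card (Slot m qR))))).filter
          fun f => cutCount (a : Finset (Fin (Fintype.card (Slot m qR)))) f = 1).card : ℝ) - 1) = 1 ∧
        (∀ a b, W a b ≤ K a b) ∧ (∀ a b, 0 ≤ K a b) ∧ ∑ a, ∑ b, K a b ≤ 1 ∧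
        (∀ a b, 0 ≤ K₂ a b) ∧ ∑ a, ∑ b, K₂ a b ≤ 1 / 74 ∧
        (∀ (a : {U : Finset (Fin (Fintype.card (Slot m qR))) // U.card = tCut qR μ})
          (b : {M : Finset (Sym2 (Fin (Fintype.card (Slot m qR)))) // IsPMOn univ M}),
          ((b : Finset (Sym2 (Fin (Fintype.card (Slot m qR))))).filter
            (fun f => cutCount (a : Finset (Fin (Fintype.card (Slot m qR)))) f = 1)).card ≠ 1 →
          W a b = K a b - K₂ a b) := by
  have hq : 0 < qR := by unfold qR; norm_num
  have hqe : Even qR := by unfold qR; decide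
  have hε : (0 : ℝ) < εR := by unfold εR; norm_num
  have h74 : (1 : ℝ) / ((qR : ℝ) + 2) = 1 / 74 := by unfold qR; norm_num
  rw [← h74]
  exact exists_WK2_transport (Fintype.equivFin (Slot m qR)) (tCut qR μ) (2 * θR m) 1 1 (1 / ((qR : ℝ) + 2))
    (exists_WK2_slot (m := m) (q := qR) μ εR (θR m) hq hqe hm hε (θR_pos m) (θR_le_one m)
      (betaU_ok μ hm hU1 hU2) (betaM_ok hM1) hk_num)

end Literature.Barriers.PneNP

end
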